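import Mathlib
import HarnessLib
import Literature.MathematicalPhysics.StatisticalMechanics.LinearisedMap

/-!
# The index set `{X ∈ 𝓟_k : π(X) = U}` of the renormalisation map splits into single blocks, large
# connected polymers, and disconnected polymers ([ABKM19] Ch. 9.1 / Ch. 10.1)

The reblocked sum `S(H,K)(U) = Σ_{X ∈ 𝓟_k, π(X)=U} …` (`GradientRG.nextKStep_eq_sum`) and the
linearisation `C_k K(U) = Σ_{B ∈ 𝓑_k, B̄=U} blockTerm(B) + Σ_{X ∈ 𝓟_k^c∖𝓑_k, π(X)=U} R K(X)`
(`LinearisedMap.opC` = `blockPart` over `blockPartIndex D U` + `largePart` over `largePartIndex s L U`)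
are indexed compatibly: the `π`-preimages of `U` are exactly the single `k`-blocks `B` with `B̄ = U`
(`blockPartIndex`), the connected `k`-polymers with at least two blocks and `π(X) = U`
(`largePartIndex`), and the disconnected ones (whose contribution to `S` is of second order because
`K` factorises over at least two components).  This file records the bookkeeping:

* `reblock_blockOf` — `π(B) = B̄'` for a single `k`-block (`= closure`, the `(k+1)`-block containing it);
* `filter_reblock_isConn_card_eq_one`, `filter_reblock_isConn_two_le` — the connected `π`-preimages with one
  block resp. at least two blocks ARE `blockPartIndex D U` resp. `largePartIndex s L U`;
* **`sum_filter_reblock_eq_three`** — `Σ_{π(X)=U} f(X) = Σ_{B ∈ blockPartIndex} f(B) + Σ_{X ∈ largePartIndex} f(X)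
  + Σ_{π(X)=U, X disconnected} f(X)`.

Everything is proved; no named fact.

## References
* S. Adams, S. Buchholz, R. Kotecký, S. Müller, arXiv:1910.13564, Ch. 9.1, Ch. 10.1 ((10.2)–(10.3))
  [AdamsBuchholzKoteckyMuller2019].
-/

noncomputable section

namespace Literature.MathematicalPhysics.StatisticalMechanics.GradientRG

open scoped BigOperators Classical
open Finset
open Literature.MathematicalPhysics.StatisticalMechanics.TorusPolymer
  (IsPolymer blocks polys blockOf closure reblock mem_polys mem_blocks isPolymer_blockOf blocks_blockOf
    mem_blockOf_self blockOf_eq_of_mem)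
open Literature.Barriers.CriticalPhenomena.LongRangePhi4.Polymer (IsConn)

variable {d M : ℕ} [NeZero M]

/-- **`π(B) = B̄`** for a single `k`-block: the reblocking map sends `B_x` to the `(k+1)`-block of `x`
(odd torus, odd sides). [cite: AdamsBuchholzKoteckyMuller2019, Ch. 6.3 (6.25)] -/
theorem reblock_blockOf (hMo : Odd M) {s L : ℕ} (hs : Odd s) (hL : Odd L) (x : Fin d → ZMod M) :
    reblock s (L * s) (blockOf s x) = blockOf (L * s) x := by
  have hc : IsConn (blockOf s x) := TorusPolymer.isConn_blockOf hMo hs x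
  have hsmall : (blocks s (blockOf s x)).card ≤ 2 ^ d := by
    rw [blocks_blockOf, card_singleton]; exact Nat.one_le_two_pow
  obtain ⟨x', hx', hπ⟩ := TorusPolymer.reblock_of_isConn_of_card_le s (L * s) hc hsmall
  rw [hπ]
  exact blockOf_eq_of_mem (TorusPolymer.blockOf_subset_blockOf_mul hs hL x hx')

/-- A `k`-polymer with exactly one block is that block. [cite: AdamsBuchholzKoteckyMuller2019, Ch. 6.2] -/
theorem eq_blockOf_of_card_blocks_eq_one {s : ℕ} {X : Finset (Fin d → ZMod M)} (hX : IsPolymer s X)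
    (h1 : (blocks s X).card = 1) : ∃ x ∈ X, X = blockOf s x := by
  obtain ⟨B, hB⟩ := card_eq_one.1 h1
  have hBm : B ∈ blocks s X := by rw [hB]; exact mem_singleton_self B
  obtain ⟨x, hx, rfl⟩ := mem_blocks.1 hBm
  refine ⟨x, hx, ?_⟩
  have := hX.biUnion_blocks
  rw [hB, singleton_biUnion] at this
  exact this.symm

/-- **The connected `π`-preimages of `U` with one block are `blockPartIndex D U`** (`D.s = L^k` odd,
`D.L = L` odd, odd torus). [cite: AdamsBuchholzKoteckyMuller2019, Ch. 10.1 (10.3)] -/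
theorem filter_reblock_isConn_card_eq_one (D : StepData d M) (hMo : Odd M) (hs : Odd D.s) (hL : Odd D.L)
    (U : Finset (Fin d → ZMod M)) :
    ((polys D.s univ).filter (fun X => reblock D.s (D.L * D.s) X = U)).filter
        (fun X => IsConn X ∧ (blocks D.s X).card = 1) = blockPartIndex D U := by
  ext X
  rw [mem_filter, mem_filter, blockPartIndex, mem_filter, mem_polys, mem_blocks]
  constructor
  · rintro ⟨⟨⟨-, hXp⟩, hXU⟩, -, h1⟩
    obtain ⟨x, -, rfl⟩ := eq_blockOf_of_card_blocks_eq_one hXp h1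
    refine ⟨⟨x, mem_univ _, rfl⟩, ?_⟩
    rw [closure_blockOf_mul hs hL x, ← reblock_blockOf hMo hs hL x]
    exact hXU
  · rintro ⟨⟨x, -, rfl⟩, hcl⟩
    refine ⟨⟨⟨subset_univ _, isPolymer_blockOf _ x⟩, ?_⟩, TorusPolymer.isConn_blockOf hMo hs x, ?_⟩
    · rw [reblock_blockOf hMo hs hL x, ← closure_blockOf_mul hs hL x]; exact hcl
    · rw [blocks_blockOf, card_singleton]

/-- **The connected `π`-preimages of `U` with at least two blocks are `largePartIndex D.s D.L U`.**
[cite: AdamsBuchholzKoteckyMuller2019, Ch. 10.1 (10.2)] -/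
theorem filter_reblock_isConn_two_le (D : StepData d M) (U : Finset (Fin d → ZMod M)) :
    ((polys D.s univ).filter (fun X => reblock D.s (D.L * D.s) X = U)).filter
        (fun X => IsConn X ∧ 2 ≤ (blocks D.s X).card) = largePartIndex D.s D.L U := by
  ext X
  rw [mem_filter, mem_filter, mem_largePartIndex, mem_polys]
  constructor
  · rintro ⟨⟨⟨-, hXp⟩, hXU⟩, hc, h2⟩; exact ⟨hXp, hc, h2, hXU⟩
  · rintro ⟨hXp, hc, h2, hXU⟩; exact ⟨⟨⟨subset_univ _, hXp⟩, hXU⟩, hc, h2⟩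

/-- **Three-way split of the `π`-preimages of `U`**: single blocks (`blockPartIndex`), large connected
polymers (`largePartIndex`), disconnected polymers:
`Σ_{π(X)=U} f(X) = Σ_{B ∈ blockPartIndex D U} f(B) + Σ_{X ∈ largePartIndex} f(X) + Σ_{π(X)=U, ¬conn} f(X)`.
[cite: AdamsBuchholzKoteckyMuller2019, Ch. 9.1 / Ch. 10.1 ((10.2)–(10.3))] -/
theorem sum_filter_reblock_eq_three {A : Type*} [AddCommMonoid A] (D : StepData d M) (hMo : Odd M)
    (hs : Odd D.s) (hL : Odd D.L) (U : Finset (Fin d → ZMod M)) (f : Finset (Fin d → ZMod M) → A) :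
    ∑ X ∈ (polys D.s univ).filter (fun X => reblock D.s (D.L * D.s) X = U), f X =
      ∑ B ∈ blockPartIndex D U, f B + ∑ X ∈ largePartIndex D.s D.L U, f X +
        ∑ X ∈ ((polys D.s univ).filter (fun X => reblock D.s (D.L * D.s) X = U)).filter (fun X => ¬ IsConn X),
          f X := by
  set 𝓧 := (polys D.s univ).filter (fun X => reblock D.s (D.L * D.s) X = U) with h𝓧
  rw [← sum_filter_add_sum_filter_not 𝓧 (fun X => IsConn X)]
  congr 1
  -- the connected ones: one block or at least two
  rw [← filter_reblock_isConn_card_eq_one D hMo hs hL U, ← filter_reblock_isConn_two_le D U, ← h𝓧]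
  rw [← sum_filter_add_sum_filter_not (𝓧.filter fun X => IsConn X) (fun X => (blocks D.s X).card = 1)]
  have hA : (𝓧.filter fun X => IsConn X).filter (fun X => (blocks D.s X).card = 1) =
      𝓧.filter (fun X => IsConn X ∧ (blocks D.s X).card = 1) := filter_filter _ _ _
  have hB : (𝓧.filter fun X => IsConn X).filter (fun X => ¬ (blocks D.s X).card = 1) =
      𝓧.filter (fun X => IsConn X ∧ 2 ≤ (blocks D.s X).card) := by
    rw [filter_filter]
    refine filter_congr fun X _ => ?_
    constructor
    · rintro ⟨hc, h1⟩
      refine ⟨hc, ?_⟩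
      have hpos : 0 < (blocks D.s X).card := by
        obtain ⟨x, hx⟩ := hc.1
        exact card_pos.2 ⟨blockOf D.s x, mem_blocks.2 ⟨x, hx, rfl⟩⟩
      omega
    · rintro ⟨hc, h2⟩; exact ⟨hc, by omega⟩
  rw [hA, hB]

end Literature.MathematicalPhysics.StatisticalMechanics.GradientRG

end
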